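import Literature.AlgebraicGeometry.Motives.AimedSplitProduct
import Literature.AlgebraicGeometry.Motives.AimedSplitProductCounterexampleClass
import Literature.AlgebraicGeometry.HodgeTheory.EisensteinCurveSqrtMinusThree
import Literature.AlgebraicGeometry.HodgeTheory.HodgeRiemannDegreeOne
import Literature.AlgebraicGeometry.HodgeTheory.KaehlerClassPullback
import Literature.AlgebraicGeometry.HodgeTheory.HyperplaneClassLine
import Literature.AlgebraicGeometry.HodgeTheory.DegreeOneHodgeTypes
import Literature.AlgebraicGeometry.HodgeTheory.WeilTypeSignatureBound
import Literature.AlgebraicGeometry.HodgeTheory.WeilSurfaceTestClassMultiplicities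
import HarnessLib

/-!
# Refutation of `Motives.exists_cmWeilSurface_aimedSplitProduct` (the aiming half fails at `d = 3`)

Family `hodge`, layer `Literature/AlgebraicGeometry/Motives`. The named fact
`Motives.exists_cmWeilSurface_aimedSplitProduct` (file `Motives/AimedSplitProduct`) asserts, for EVERY
`d > 0`, a "Weil surface" `(B, ψ)` such that for every `(A, φ)`, `dim A = 2n`, `φ² = -d`, carrying
a non-zero rational `(n,n)`-class in the "single-test Weil span"
`Eig((𝟙+φ)^*, (1+i√d)^{2n}) + Eig((𝟙+φ)^*, (1-i√d)^{2n})` of `H^{2n}(A)`, the product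
`(A × B, φ × ψ)` is of hyperbolic Weil type (`Motives.IsHyperbolicWeilType`: a rational
`(φ × ψ)^*`-stable `2(n+1)`-frame of `H¹((A × B)(ℂ); ℂ)`, Lagrangian for the polarization pairing
`Q_h`, `h = d·ι^*a + (φ × ψ)^* ι^*a`). Its docstring (session of 2026-08-16) records why this is
FALSE for `d ∈ {1, 3}`: the single test endomorphism cannot tell `⋀^{2n}V₊` from
`⋀^{n-1}V₊ ⊗ ⋀^{n+1}V₋` when `((1-i√d)/(1+i√d))^{n+1} = 1`. This file PROVES the negation:

* `not_exists_cmWeilSurface_aimedSplitProduct : ¬ exists_cmWeilSurface_aimedSplitProduct`.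

**Proof** (`d = 3`, `n = 2`). Let `E = E_ω = ℂ/ℤ[ω]` with `ρ = [ω] + [ω] + 1`, `ρ² = -3`
(`HodgeTheory.WeilSquare.rho_comp_rho_nsmul`), and `A = E × (E × E) × E` with
`φ = ρ × (ρ × (-ρ)) × ρ` (`EisensteinCounterexample.phiOf`); `A` carries the required class
(`EisensteinCounterexample.exists_singleTest_weilSpan_class`), so the fact yields a projective
embedding `ι` of `A × B`, a rational `a ≠ 0` and a rational `Φ^*`-stable `Q_h`-Lagrangian `6`-frame
`u` of `H¹(A × B)`, `Φ = φ × ψ`, `h = 3 ι^*a + Φ^* ι^*a`. Now: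
1. `ι^*a = s · H_K` with `s ∈ ℝ^×` and `H_K` the Kähler class of the restricted Fubini–Study metric
   (`exists_real_map_eq_smul_of_pullback_eq_fubiniStudy`), and `3 H_K + Φ^* H_K` is again a Kähler
   class (`IsKaehlerClassVia.natCast_smul_add_map`), so `h = s · H'`, `H'` Kähler;
2. Hodge–Riemann in degree one (`IsKaehlerClass.hodgeRiemann_one_smul`): there is a functional `τ`
   on `H¹²` with `i τ(x ⌣ x̄ ⌣ h⁵) > 0` for `x ≠ 0` of type `(1,0)`;
3. the signature bound (`HodgeTheory.finrank_le_two_mul_min`): `W = span u` is `Φ^*`-stable, real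
   and `τ ∘ Q_h`-isotropic (`Q_h(x,y) = x ⌣ y ⌣ h⁵`,
   `polarizationPairingOne_eq_cupProduct_cupPowTwo`), `Φ^* Φ^* = -3`, hence
   `6 = dim W ≤ 2 min (p, q)` for the multiplicities `(p, q)` of `i√3` on `H^{1,0}`, `H^{0,1}` of
   `A × B`;
4. the multiplicities add over products (`finrank_eigenspace_inf_hodgeOneZero_prod`): those of
   `(E, ±ρ)` are `(ε, 1-ε)`, `(1-ε, ε)` (`dim H^{1,0}(E) = 1`), so `(A, φ)` has `(1+2ε, 3-2ε)`, and
   `(B, ψ)` has `(1, 1)` because of the test classes `b_±` the fact provides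
   (`finrank_eigenspace_inf_hodge_eq_one_of_testClasses`); so `(p, q) = (2+2ε, 4-2ε)`,
   `min (p, q) = 2`, and `6 ≤ 4` is absurd.

This is van Geemen's Lemma 5.2 (1) read backwards (an `N`-dimensional isotropic subspace of
`(K^{2N}, H)` forces signature `(N, N)`), [vanGeemen1994HodgeAV]; Markman §11.5.
No definition and no named fact is introduced (D-0026); the corrected statement is the tree's
`Motives.exists_cmWeilSurface_aimedSplitProduct_of_ne_one_of_ne_three`.

## References

* [vanGeemen1994HodgeAV] B. van Geemen, An introduction to the Hodge conjecture for abelian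
  varieties, LNM 1594 (1994), 4.9, Lemma 5.2, 5.3–5.8, 6.11–6.12.
* [Markman2025SurveySecant] E. Markman, arXiv:2509.23403, §11.5.
* [VoisinHodgeI2002] C. Voisin, Hodge Theory and Complex Algebraic Geometry I (CUP 2002), Thm. 6.32,
  §7.1.2.
-/

noncomputable section

open scoped Manifold ContDiff
open CategoryTheory AlgebraicGeometry
open Literature.AlgebraicTopology.SingularHomology Literature.Geometry.Kaehler
open Literature.AlgebraicGeometry.HodgeTheory
open Literature.NumberTheory.Transcendental
open Literature.AlgebraicGeometry.Motives.AnalytificationKaehler (fubiniStudyPullbackForm)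

namespace Literature.AlgebraicGeometry.Motives

section Refutation

open EisensteinCounterexample

/-! ### Multiplicities of a CM elliptic curve and of the fourfold `E × (E × E) × E` -/

/-- The eigenspace of `(-r)^* = -r^*` for `μ` is the eigenspace of `r^*` for `-μ` (on `H¹`).
[cite: LangeBirkenhake1992, §1.1 Lemma 1.1.17] -/
theorem eigenspace_map_neg_one {E : AbelianVariety ℂ} (r : E ⟶ E) (μ : ℂ) :
    Module.End.eigenspace (complexBetti.map (-r).hom.hom.hom 1).hom μ =
      Module.End.eigenspace (complexBetti.map r.hom.hom.hom 1).hom (-μ) := by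
  ext v
  simp only [Module.End.mem_eigenspace_iff]
  change complexBetti.map (-r).hom.hom.hom 1 v = μ • v ↔ complexBetti.map r.hom.hom.hom 1 v = -μ • v
  rw [complexBetti_map_neg_deg_one, neg_eq_iff_eq_neg, neg_smul]

/-- **Multiplicities of a CM elliptic curve**: for `dim E = 1`, `r ≫ r = -d` (`d > 0`), `μ = i√d`:
`p_μ + q_μ = 1` (`dim V_μ = 1`, `b₁ = 2`), and `(p_{-μ}, q_{-μ}) = (q_μ, p_μ)` (conjugation).
[cite: vanGeemen1994HodgeAV, 4.9 and 5.7] -/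
theorem curve_multiplicities {E : AbelianVariety ℂ} (hE : E.dim = 1) {r : E ⟶ E} {d : ℕ} (hd : 0 < d)
    (hr : r ≫ r = -(d • 𝟙 E)) :
    Module.finrank ℂ ↥(Module.End.eigenspace (complexBetti.map r.hom.hom.hom 1).hom
        (Complex.I * (Real.sqrt d : ℂ)) ⊓ hodgeOneZero (isSmoothProjective_of_dim_eq' hE)) +
      Module.finrank ℂ ↥(Module.End.eigenspace (complexBetti.map r.hom.hom.hom 1).hom
        (Complex.I * (Real.sqrt d : ℂ)) ⊓ hodgeZeroOne (isSmoothProjective_of_dim_eq' hE)) = 1 ∧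
    Module.finrank ℂ ↥(Module.End.eigenspace (complexBetti.map r.hom.hom.hom 1).hom
        (-(Complex.I * (Real.sqrt d : ℂ))) ⊓ hodgeOneZero (isSmoothProjective_of_dim_eq' hE)) =
      Module.finrank ℂ ↥(Module.End.eigenspace (complexBetti.map r.hom.hom.hom 1).hom
        (Complex.I * (Real.sqrt d : ℂ)) ⊓ hodgeZeroOne (isSmoothProjective_of_dim_eq' hE)) ∧
    Module.finrank ℂ ↥(Module.End.eigenspace (complexBetti.map r.hom.hom.hom 1).hom
        (-(Complex.I * (Real.sqrt d : ℂ))) ⊓ hodgeZeroOne (isSmoothProjective_of_dim_eq' hE)) =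
      Module.finrank ℂ ↥(Module.End.eigenspace (complexBetti.map r.hom.hom.hom 1).hom
        (Complex.I * (Real.sqrt d : ℂ)) ⊓ hodgeOneZero (isSmoothProjective_of_dim_eq' hE)) := by
  haveI := finite_complexBetti_abelianVariety E 1
  set μ : ℂ := Complex.I * (Real.sqrt d : ℂ) with hμ
  have hconj : (starRingEnd ℂ) μ = -μ := by
    rw [hμ, map_mul, Complex.conj_I, Complex.conj_ofReal, neg_mul]
  have hconj' : (starRingEnd ℂ) (-μ) = μ := by rw [map_neg, hconj, neg_neg]
  refine ⟨?_, ?_, ?_⟩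
  · have h := two_mul_finrank_eigenspace_eq hd hr
    rw [finrank_complexBetti_one_of_dim_eq_one hE] at h
    have h1 : Module.finrank ℂ ↥(Module.End.eigenspace (complexBetti.map r.hom.hom.hom 1).hom μ) = 1 := by
      change 2 * Module.finrank ℂ ↥(Module.End.eigenspace (complexBetti.map r.hom.hom.hom 1).hom μ) = 2 at h
      omega
    have h2 := finrank_eigenspace_eq_add (isSmoothProjective_of_dim_eq' hE) r.hom.hom.hom μ
    rw [h1] at h2
    exact h2.symm
  · rw [← finrank_eigenspace_inf_hodgeZeroOne_eq (isSmoothProjective_of_dim_eq' hE) r.hom.hom.hom (-μ), hconj']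
  · rw [← hconj]
    exact finrank_eigenspace_inf_hodgeZeroOne_eq (isSmoothProjective_of_dim_eq' hE) r.hom.hom.hom μ

/-- **Multiplicities of the CM fourfold `(A, φ_r) = (E × (E × E) × E, r × (r × (-r)) × r)`**:
`(p, q) = (1 + 2ε, 3 - 2ε)` where `(ε, 1 - ε)` are those of `(E, r)` — the multiplicities add over
products and `(E, -r)` has `(1 - ε, ε)`. Stated as the two linear identities `p_A = 3 p_E + q_E`,
`q_A = 3 q_E + p_E`. [cite: vanGeemen1994HodgeAV, 4.9 and proof of Lemma 5.2 (3)] -/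
theorem fourfold_multiplicities {E : AbelianVariety ℂ} (hE : E.dim = 1) {r : E ⟶ E} {d : ℕ} (hd : 0 < d)
    (hr : r ≫ r = -(d • 𝟙 E)) :
    Module.finrank ℂ ↥(Module.End.eigenspace (complexBetti.map (phiOf r).hom.hom.hom 1).hom
        (Complex.I * (Real.sqrt d : ℂ)) ⊓ hodgeOneZero (isSmoothProjective_of_dim_eq'
          (show (fourfold E).dim = (1 + (1 + 1)) + 1 by simp only [AbelianVariety.dim_prod, hE]))) =
      3 * Module.finrank ℂ ↥(Module.End.eigenspace (complexBetti.map r.hom.hom.hom 1).hom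
        (Complex.I * (Real.sqrt d : ℂ)) ⊓ hodgeOneZero (isSmoothProjective_of_dim_eq' hE)) +
      Module.finrank ℂ ↥(Module.End.eigenspace (complexBetti.map r.hom.hom.hom 1).hom
        (Complex.I * (Real.sqrt d : ℂ)) ⊓ hodgeZeroOne (isSmoothProjective_of_dim_eq' hE)) ∧
    Module.finrank ℂ ↥(Module.End.eigenspace (complexBetti.map (phiOf r).hom.hom.hom 1).hom
        (Complex.I * (Real.sqrt d : ℂ)) ⊓ hodgeZeroOne (isSmoothProjective_of_dim_eq'
          (show (fourfold E).dim = (1 + (1 + 1)) + 1 by simp only [AbelianVariety.dim_prod, hE]))) =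
      3 * Module.finrank ℂ ↥(Module.End.eigenspace (complexBetti.map r.hom.hom.hom 1).hom
        (Complex.I * (Real.sqrt d : ℂ)) ⊓ hodgeZeroOne (isSmoothProjective_of_dim_eq' hE)) +
      Module.finrank ℂ ↥(Module.End.eigenspace (complexBetti.map r.hom.hom.hom 1).hom
        (Complex.I * (Real.sqrt d : ℂ)) ⊓ hodgeOneZero (isSmoothProjective_of_dim_eq' hE)) := by
  set μ : ℂ := Complex.I * (Real.sqrt d : ℂ) with hμ
  have hS : (surface E).dim = 1 + 1 := by simp only [AbelianVariety.dim_prod, hE]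
  have hP : (threefold E).dim = 1 + (1 + 1) := by simp only [AbelianVariety.dim_prod, hE]
  obtain ⟨hsum, hpneg, hqneg⟩ := curve_multiplicities hE hd hr
  rw [← hμ] at hsum hpneg hqneg
  -- unfold the tower `A = P × E`, `P = E × S`, `S = E × E`
  have eA : phiOf r = AbelianVariety.prodLift (AbelianVariety.fst (threefold E) E ≫ phiPOf r)
      (AbelianVariety.snd (threefold E) E ≫ r) := rfl
  have eP : phiPOf r = AbelianVariety.prodLift (AbelianVariety.fst E (surface E) ≫ r)
      (AbelianVariety.snd E (surface E) ≫ psiOf r) := rfl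
  have eS : psiOf r = AbelianVariety.prodLift (AbelianVariety.fst E E ≫ r)
      (AbelianVariety.snd E E ≫ (-r)) := rfl
  constructor
  · rw [eA, finrank_eigenspace_inf_hodgeOneZero_prod hP hE (phiPOf r) r μ, eP,
      finrank_eigenspace_inf_hodgeOneZero_prod hE hS r (psiOf r) μ, eS,
      finrank_eigenspace_inf_hodgeOneZero_prod hE hE r (-r) μ, eigenspace_map_neg_one, hpneg]
    ring
  · rw [eA, finrank_eigenspace_inf_hodgeZeroOne_prod hP hE (phiPOf r) r μ, eP,
      finrank_eigenspace_inf_hodgeZeroOne_prod hE hS r (psiOf r) μ, eS,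
      finrank_eigenspace_inf_hodgeZeroOne_prod hE hE r (-r) μ, eigenspace_map_neg_one, hqneg]
    ring

/-! ### Closure properties of the span of a rational stable Lagrangian frame -/

section Frame

variable {X : SchemeOver ℂ} {ι : Type*} (u : ι → complexBetti X 1)

/-- The span of conjugation-invariant classes is conjugation-closed (conjugation is conjugate-linear).
[cite: VoisinHodgeI2002, §7.1.1] -/
theorem conjClass_mem_span (hu : ∀ i, conjClass (ComplexPoints X) 1 (u i) = u i)
    {w : complexBetti X 1} (hw : w ∈ Submodule.span ℂ (Set.range u)) :
    conjClass (ComplexPoints X) 1 w ∈ Submodule.span ℂ (Set.range u) := by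
  induction hw using Submodule.span_induction with
  | mem x hx =>
    obtain ⟨i, rfl⟩ := hx
    rw [hu i]
    exact Submodule.subset_span ⟨i, rfl⟩
  | zero => rw [conjClass_zero]; exact Submodule.zero_mem _
  | add x y _ _ hx hy => rw [conjClass_add]; exact Submodule.add_mem _ hx hy
  | smul c x _ hx => rw [conjClass_smul]; exact Submodule.smul_mem _ _ hx

/-- The span of a `T`-stable family is `T`-stable. [folklore] -/
theorem map_mem_span (T : complexBetti X 1 →ₗ[ℂ] complexBetti X 1)
    (hu : ∀ i, T (u i) ∈ Submodule.span ℂ (Set.range u))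
    {w : complexBetti X 1} (hw : w ∈ Submodule.span ℂ (Set.range u)) :
    T w ∈ Submodule.span ℂ (Set.range u) := by
  have hle : Submodule.span ℂ (Set.range u) ≤ (Submodule.span ℂ (Set.range u)).comap T :=
    Submodule.span_le.2 (by rintro _ ⟨i, rfl⟩; exact hu i)
  exact hle hw

end Frame

/-! ### The refutation -/

-- names the `@[deprecated]` record `exists_cmWeilSurface_aimedSplitProduct` of `AimedSplitProduct.lean` on purpose:
-- this IS its refutation (verdict clean-up 2026-08-16, p116666); REMOVE-WHEN the record is deleted from that file
set_option linter.deprecated false in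
/-- **`Motives.exists_cmWeilSurface_aimedSplitProduct` is false** (it fails at `d = 3`, `n = 2`,
`A = E_ω × (E_ω × E_ω) × E_ω`, `φ = ρ × (ρ × (-ρ)) × ρ`, `ρ² = -3`): whatever the Weil surface
`(B, ψ)`, a rational `(φ × ψ)^*`-stable `Q_h`-Lagrangian `6`-frame of `H¹((A × B)(ℂ); ℂ)` would be
a `6`-dimensional real isotropic stable subspace, but Hodge–Riemann in degree one bounds those by
`2 · min (p, q) = 4` for the multiplicities `(p, q) ∈ {(4,2), (2,4)}` of `i√3` on
`H^{1,0} ⊕ H^{0,1}` of `A × B`. See the module docstring. [cite: vanGeemen1994HodgeAV, Lemma 5.2 (1), 5.3–5.8]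
[cite: Markman2025SurveySecant, §11.5] [cite: VoisinHodgeI2002, Thm. 6.32] -/
theorem not_exists_cmWeilSurface_aimedSplitProduct : ¬ exists_cmWeilSurface_aimedSplitProduct := by
  intro hfact
  obtain ⟨B, ψ, hB2, hψz, ⟨bp, bm, η, hbp, hbm, -, h11, -, hbpη, hbmη⟩, hall⟩ := hfact 3 (by norm_num)
  -- the surface data: multiplicities `(1, 1)`
  have hψ : ψ ≫ ψ = -((3 : ℕ) • 𝟙 B) := by rw [← natCast_zsmul]; exact hψz
  have hbp0 : bp ≠ 0 := by rintro rfl; exact hbpη (by rw [LinearMap.map_zero₂])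
  have hbm0 : bm ≠ 0 := by rintro rfl; exact hbmη (by rw [LinearMap.map_zero₂])
  obtain ⟨hpB, hqB⟩ := finrank_eigenspace_inf_hodge_eq_one_of_testClasses hB2 ψ (d := 3) (by norm_num)
    hψ hbp hbm h11 hbp0 hbm0
  -- the CM fourfold on an abstract CM curve `(E, r)`, `dim E = 1`, `r ≫ r = -3` (here `E_ω`, `ρ`)
  obtain ⟨E, hE, r, hr⟩ :
      ∃ E : AbelianVariety ℂ, E.dim = 1 ∧ ∃ r : E ⟶ E, r ≫ r = -((3 : ℕ) • 𝟙 E) :=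
    ⟨_, WeilSquare.dim_eisensteinCurve, _, WeilSquare.rho_comp_rho_nsmul⟩
  have hA : (fourfold E).dim = 2 * 2 := dim_fourfold hE
  have hφ : phiOf r ≫ phiOf r = -((3 : ℕ) • 𝟙 (fourfold E)) := phiOf_comp_phiOf hr
  have hφz : phiOf r ≫ phiOf r = -(((3 : ℕ) : ℤ) • 𝟙 (fourfold E)) := by
    rw [natCast_zsmul]; exact hφ
  obtain ⟨c, hc0, hcrat, hcH, hcmem⟩ := exists_singleTest_weilSpan_class hE hr
  obtain ⟨emb, a, harat, ha0, u, hurat, hli, hstab, hiso⟩ :=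
    hall 2 (fourfold E) (phiOf r) hA hφz ⟨c, hc0, hcrat, hcH, hcmem⟩
  -- `Φ = φ × ψ`
  obtain ⟨Φ, hΦdef⟩ : ∃ Φ : (fourfold E).prod B ⟶ (fourfold E).prod B, Φ = AbelianVariety.prodLift
      (AbelianVariety.fst (fourfold E) B ≫ phiOf r) (AbelianVariety.snd (fourfold E) B ≫ ψ) := ⟨_, rfl⟩
  rw [← hΦdef] at hstab hiso
  -- dimensions
  have hA' : (fourfold E).dim = (1 + (1 + 1)) + 1 := by simp only [AbelianVariety.dim_prod, hE]
  have hX₆ : IsSmoothProjective ((1 + (1 + 1)) + 1 + 2) ((fourfold E).prod B).X :=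
    isSmoothProjective_of_dim_eq' (show ((fourfold E).prod B).dim = (1 + (1 + 1)) + 1 + 2 by
      rw [AbelianVariety.dim_prod, hA', hB2])
  haveI := finite_complexBetti_abelianVariety ((fourfold E).prod B) 1
  -- `Φ ≫ Φ = -3`, `Φ^* Φ^* = -3` on `H¹`
  have hΦ : Φ ≫ Φ = -((3 : ℕ) • 𝟙 ((fourfold E).prod B)) := by
    rw [hΦdef]; exact prodLift_sq_eq_neg hφ hψ
  have hT2 : ∀ v : complexBetti ((fourfold E).prod B).X 1, (complexBetti.map Φ.hom.hom.hom 1).hom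
      ((complexBetti.map Φ.hom.hom.hom 1).hom v) = -(((3 : ℕ) : ℂ) • v) :=
    fun v ↦ complexBetti_map_map_one_of_comp_self hΦ v
  -- the Kähler class `H_K` of the embedding and `ι^*a = s H_K`
  obtain ⟨M⟩ := nonempty_hodgeModel_holds.nonempty hX₆
  obtain ⟨e, he, hem, -⟩ := exists_deRhamIsoFamily_holds M.model
  have hθ := M.fubiniStudyPullbackForm_mem_closedSmoothForms emb.ι
  obtain ⟨HK, hHK⟩ := M.pullback_surjective 2 (ofRealClass M.carrier 2 (e M.carrier 2
    (deRhamCohomology.mk ⟨fubiniStudyPullbackForm M.model emb.ι M.toComplexPoints, hθ⟩)))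
  have hKvia : M.IsKaehlerClassVia e HK :=
    M.isKaehlerClassVia_of_pullback_eq_fubiniStudyPullbackForm e hX₆ emb.ι hθ hHK
  obtain ⟨s, hs0, hsa⟩ := exists_real_map_eq_smul_of_pullback_eq_fubiniStudy hX₆ (by norm_num) M
    emb.ι e he hθ hHK harat ha0
  -- `H' = 3 H_K + Φ^* H_K` is Kähler and `h = 3 ι^*a + Φ^* ι^*a = s H'`
  obtain ⟨H', hH'def⟩ : ∃ H' : complexBetti ((fourfold E).prod B).X 2,
      H' = ((3 : ℕ) : ℂ) • HK + complexBetti.map Φ.hom.hom.hom 2 HK := ⟨_, rfl⟩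
  have hK' : IsKaehlerClass ((1 + (1 + 1)) + 1 + 2) ((fourfold E).prod B).X H' := by
    rw [hH'def]
    exact (hKvia.natCast_smul_add_map he hX₆ Φ.hom.hom.hom (d := 3) (by norm_num)).isKaehlerClass
      he hem
  have hh : ((3 : ℕ) : ℂ) • complexBetti.map emb.ι 2 a +
      complexBetti.map Φ.hom.hom.hom 2 (complexBetti.map emb.ι 2 a) = (s : ℂ) • H' := by
    rw [hsa, map_smul, smul_comm ((3 : ℕ) : ℂ) (s : ℂ) HK, hH'def, smul_add]
  -- Hodge–Riemann in degree one for the Kähler class `H'`, scaled by `s`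
  obtain ⟨τ, hτ⟩ := IsKaehlerClass.hodgeRiemann_one_smul (m := 5) (X := ((fourfold E).prod B).X)
    (by norm_num) (show IsSmoothProjective (5 + 1) ((fourfold E).prod B).X from hX₆)
    (show IsKaehlerClass (5 + 1) ((fourfold E).prod B).X H' from hK') hs0
  obtain ⟨P, hPdef⟩ :
      ∃ P : complexBetti ((fourfold E).prod B).X (2 * 5), P = cupPowTwo ((s : ℂ) • H') 5 := ⟨_, rfl⟩
  rw [← hPdef] at hτ
  have hτ' : ∀ x ∈ hodgeOneZero hX₆, x ≠ 0 → τ (cupProduct rfl x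
      (cupProduct rfl (conjClass (ComplexPoints ((fourfold E).prod B).X) 1 x) P)) ≠ 0 := by
    intro x hx hx0 h0
    have h := (hτ x ((mem_hodgeOneZero hX₆).1 hx) hx0).1
    rw [h0, mul_zero, Complex.zero_re] at h
    exact lt_irrefl _ h
  -- the frame: `W = span u` is `Φ^*`-stable, real, and `τ ∘ Q_h`-isotropic
  have hWT : ∀ w ∈ Submodule.span ℂ (Set.range u),
      (complexBetti.map Φ.hom.hom.hom 1).hom w ∈ Submodule.span ℂ (Set.range u) :=
    fun w hw ↦ map_mem_span u _ hstab hw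
  have hWc : ∀ w ∈ Submodule.span ℂ (Set.range u),
      conjClass (ComplexPoints ((fourfold E).prod B).X) 1 w ∈ Submodule.span ℂ (Set.range u) :=
    fun w hw ↦ conjClass_mem_span u (fun i ↦ (hurat i).conjClass_eq) hw
  let Q : complexBetti ((fourfold E).prod B).X 1 →ₗ[ℂ] complexBetti ((fourfold E).prod B).X 1 →ₗ[ℂ] ℂ :=
    LinearMap.mk₂ ℂ (fun w w' ↦ τ (cupProduct rfl w (cupProduct rfl w' P)))
      (fun w₁ w₂ w' ↦ by simp only [map_add, LinearMap.add_apply])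
      (fun t w w' ↦ by simp only [map_smul, LinearMap.smul_apply, smul_eq_mul])
      (fun w w₁ w₂ ↦ by simp only [map_add, LinearMap.add_apply])
      (fun t w w' ↦ by simp only [map_smul, LinearMap.smul_apply, smul_eq_mul])
  have hQgen : ∀ i j, Q (u i) (u j) = 0 := by
    intro i j
    have h1 : polarizationPairingOne ((fourfold E).prod B).X (((3 : ℕ) : ℂ) • complexBetti.map emb.ι 2 a +
        complexBetti.map Φ.hom.hom.hom 2 (complexBetti.map emb.ι 2 a)) 5 (u i) (u j) = 0 := hiso i j
    rw [polarizationPairingOne_eq_cupProduct_cupPowTwo, hh, ← hPdef] at h1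
    have h2 : cupProduct (rfl : 1 + (1 + 2 * 5) = 1 + (1 + 2 * 5)) (u i)
        (cupProduct rfl (u j) P) = 0 := h1
    change τ (cupProduct rfl (u i) (cupProduct rfl (u j) P)) = 0
    rw [h2, map_zero]
  have hWQ : ∀ w ∈ Submodule.span ℂ (Set.range u), ∀ w' ∈ Submodule.span ℂ (Set.range u),
      τ (cupProduct rfl w (cupProduct rfl w' P)) = 0 :=
    fun w hw w' hw' ↦ bilin_apply_eq_zero_of_mem_span Q hQgen hw hw'
  -- the signature bound: `dim W ≤ 2 min (p, q)`
  have hbound := finrank_le_two_mul_min hX₆ Φ.hom.hom.hom (d := 3) (by norm_num) hT2 P τ hτ'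
    (Submodule.span ℂ (Set.range u)) hWT hWc hWQ
  -- `dim W = 6`
  have hW6 : Module.finrank ℂ ↥(Submodule.span ℂ (Set.range u)) = 2 * (2 + 1) := by
    rw [finrank_span_eq_card hli, Fintype.card_fin]
  -- the multiplicities of `A × B`: `(p_A + 1, q_A + 1)`, `(p_A, q_A) = (3ε + ε', 3ε' + ε)`, `ε + ε' = 1`
  have hpX : Module.finrank ℂ ↥(Module.End.eigenspace (complexBetti.map Φ.hom.hom.hom 1).hom
        (Complex.I * (Real.sqrt (3 : ℕ) : ℂ)) ⊓ hodgeOneZero hX₆) =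
      Module.finrank ℂ ↥(Module.End.eigenspace (complexBetti.map (phiOf r).hom.hom.hom 1).hom
        (Complex.I * (Real.sqrt (3 : ℕ) : ℂ)) ⊓ hodgeOneZero (isSmoothProjective_of_dim_eq' hA')) +
      Module.finrank ℂ ↥(Module.End.eigenspace (complexBetti.map ψ.hom.hom.hom 1).hom
        (Complex.I * (Real.sqrt (3 : ℕ) : ℂ)) ⊓ hodgeOneZero (isSmoothProjective_of_dim_eq' hB2)) := by
    rw [hΦdef]
    exact finrank_eigenspace_inf_hodgeOneZero_prod hA' hB2 (phiOf r) ψ (Complex.I * (Real.sqrt (3 : ℕ) : ℂ))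
  have hqX : Module.finrank ℂ ↥(Module.End.eigenspace (complexBetti.map Φ.hom.hom.hom 1).hom
        (Complex.I * (Real.sqrt (3 : ℕ) : ℂ)) ⊓ hodgeZeroOne hX₆) =
      Module.finrank ℂ ↥(Module.End.eigenspace (complexBetti.map (phiOf r).hom.hom.hom 1).hom
        (Complex.I * (Real.sqrt (3 : ℕ) : ℂ)) ⊓ hodgeZeroOne (isSmoothProjective_of_dim_eq' hA')) +
      Module.finrank ℂ ↥(Module.End.eigenspace (complexBetti.map ψ.hom.hom.hom 1).hom
        (Complex.I * (Real.sqrt (3 : ℕ) : ℂ)) ⊓ hodgeZeroOne (isSmoothProjective_of_dim_eq' hB2)) := by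
    rw [hΦdef]
    exact finrank_eigenspace_inf_hodgeZeroOne_prod hA' hB2 (phiOf r) ψ (Complex.I * (Real.sqrt (3 : ℕ) : ℂ))
  obtain ⟨hpA', hqA'⟩ := fourfold_multiplicities hE (d := 3) (by norm_num) hr
  have hpA : Module.finrank ℂ ↥(Module.End.eigenspace (complexBetti.map (phiOf r).hom.hom.hom 1).hom
        (Complex.I * (Real.sqrt (3 : ℕ) : ℂ)) ⊓ hodgeOneZero (isSmoothProjective_of_dim_eq' hA')) =
      3 * Module.finrank ℂ ↥(Module.End.eigenspace (complexBetti.map r.hom.hom.hom 1).hom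
        (Complex.I * (Real.sqrt (3 : ℕ) : ℂ)) ⊓ hodgeOneZero (isSmoothProjective_of_dim_eq' hE)) +
      Module.finrank ℂ ↥(Module.End.eigenspace (complexBetti.map r.hom.hom.hom 1).hom
        (Complex.I * (Real.sqrt (3 : ℕ) : ℂ)) ⊓ hodgeZeroOne (isSmoothProjective_of_dim_eq' hE)) := hpA'
  have hqA : Module.finrank ℂ ↥(Module.End.eigenspace (complexBetti.map (phiOf r).hom.hom.hom 1).hom
        (Complex.I * (Real.sqrt (3 : ℕ) : ℂ)) ⊓ hodgeZeroOne (isSmoothProjective_of_dim_eq' hA')) =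
      3 * Module.finrank ℂ ↥(Module.End.eigenspace (complexBetti.map r.hom.hom.hom 1).hom
        (Complex.I * (Real.sqrt (3 : ℕ) : ℂ)) ⊓ hodgeZeroOne (isSmoothProjective_of_dim_eq' hE)) +
      Module.finrank ℂ ↥(Module.End.eigenspace (complexBetti.map r.hom.hom.hom 1).hom
        (Complex.I * (Real.sqrt (3 : ℕ) : ℂ)) ⊓ hodgeOneZero (isSmoothProjective_of_dim_eq' hE)) := hqA'
  obtain ⟨hsumE, -, -⟩ := curve_multiplicities hE (d := 3) (by norm_num) hr
  have hb₁ := hbound.trans (Nat.mul_le_mul_left 2 (min_le_left _ _))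
  have hb₂ := hbound.trans (Nat.mul_le_mul_left 2 (min_le_right _ _))
  rw [hW6, hpX, hpA, hpB] at hb₁
  rw [hW6, hqX, hqA, hqB] at hb₂
  omega

end Refutation

end Literature.AlgebraicGeometry.Motives

end
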